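import Mathlib
import Summits.NavierStokesRegularity.NavierStokesRegularity.Theorems.WakeRatchetAdmissibleEternalBoundFedSpike
import Summits.NavierStokesRegularity.NavierStokesRegularity.Theses.WakeRatchet
import HarnessLib

/-!
# The iterated shell step and the SMALL-ACTION LIOUVILLE theorem for admissible eternal solutions
# (support for `WakeRatchet.AdmissibleEternalBound`, stmt-NavierStokesRegularity-23197)

Continuation of `WakeRatchetAdmissibleEternalBoundFedSpike` (the fed-spike inequality `fedSpike` and
the shell step `shellStep` with fed-spike factor `K = ΛC_A M e^{C_A M/Λ}`).

* `shellStep_iter`, `shellStep_iter_global` — `‖W_{k₀}‖ ≤ S` on `(-∞, σ₀]` gives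
  `‖W_{k₀+j}‖ ≤ K^j S` there: shell suprema grow at most geometrically UP the lattice (per-shell
  boundedness propagates upward; uniformity does not follow when `K ≥ 1`).
* `eq_zero_of_uniformBound_of_fedFactor_lt_one` — SMALL-ACTION LIOUVILLE: on a cancelling table, a
  uniformly bounded admissible eternal solution (any `ν̂ ≥ 0`, any `ε₀ > 0`) with `K < 1` vanishes
  identically (`‖W_k(σ)‖ ≤ K^j C` from shell `k − j`, `j → ∞`); `fedFactor_lt_one_of_le_half`:
  `ΛC_A M ≤ 1/2` suffices; `half_lt_action_of_ne_zero`: every NON-ZERO bounded admissible eternal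
  solution has `ΛC_A M > 1/2` for each admissible action bound (an explicit action floor).
* `smallActionLiouville_of_admissibleEternalBound` — what the crux ADDS: it removes the boundedness
  hypothesis (below its threshold every admissible eternal solution of an E₂(R) table with
  `ΛC_A M ≤ 1/2` is zero).  Contrapositively: ONE persistent family of non-zero small-action admissible
  eternal solutions on a fixed-spread table refutes the crux (negative lemma in
  `Theorems/WakeRatchetAdmissibleEternalBound/Negative/`).

Reading for the planner: restricted to small action the crux is `UniformBound W ↔ W = 0`, a LIOUVILLE
statement; for large action the shell step gives only geometric growth `K^j`.  The «action ceiling»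
therefore terminates nothing by itself — consistent with the critic's P1 and the instrument j293373.

HONEST FRAMING: MODEL lattice ODEs only (Tao 2016 §4, §6.4); nothing in this file is a statement
about the Navier–Stokes equations, and no summit or rung is proved by it.
-/

noncomputable section

set_option linter.dupNamespace false

namespace Summit.NavierStokesRegularity.NavierStokesRegularity.Theorems

namespace WakeRatchetSmallAction

open Filter Topology MeasureTheory Set intervalIntegral
open scoped RealInnerProductSpace
open Literature.Analysis.FluidPDE Literature.Analysis.FluidPDE.TaoCascade
open WakeRatchetFedSpike

section ShellStepIter

variable {m : ℕ} {ε₀ νh : ℝ} {α : Fin m → Fin m → Fin m → ℤ × ℤ × ℤ → ℝ} {W : ℤ → ℝ → Em m}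

/-- **Iterated shell step.**  If `‖W_{k₀}‖ ≤ S` on `(-∞, σ₀]`, then `‖W_{k₀+j}‖ ≤ K^j S` on
`(-∞, σ₀]` for every `j : ℕ`, `K = Λ C_A M e^{C_A M/Λ}` the fed-spike factor: along a left half-line
the shell suprema grow at most geometrically with the shell index.
[cite: Tao2016AveragedNS, §4 Lemma 4.1 (4.8)–(4.10) with (4.3), §6.4; cell vocabulary] -/
theorem shellStep_iter (hε : 0 < ε₀) (hc : IsCancellingCoeff α) (hW : IsEternalVisc ε₀ νh α W)
    {M : ℝ} (hM : ∀ n : ℤ, Integrable (fun σ => ‖W n σ‖) ∧ ∫ σ, ‖W n σ‖ ≤ M)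
    (k₀ : ℤ) {σ₀ S : ℝ} (hS0 : 0 ≤ S) (hS : ∀ s, s ≤ σ₀ → ‖W k₀ s‖ ≤ S) :
    ∀ (j : ℕ) (σ : ℝ), σ ≤ σ₀ → ‖W (k₀ + j) σ‖ ≤
      (bigLam ε₀ * fluxConst α * M * Real.exp (fluxConst α * (bigLam ε₀)⁻¹ * M)) ^ j * S := by
  have hS' := table_sTable α hc
  have hΛpos : 0 < bigLam ε₀ := bigLam_pos (by linarith)
  have hM0 : 0 ≤ M := le_trans (integral_nonneg fun _ => norm_nonneg _) (hM 0).2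
  have hCA : 0 ≤ fluxConst α := hS'.CA_nonneg
  have hK0 : 0 ≤ bigLam ε₀ * fluxConst α * M * Real.exp (fluxConst α * (bigLam ε₀)⁻¹ * M) := by
    positivity
  intro j
  induction j with
  | zero => intro σ hσ; simpa using hS σ hσ
  | succ j ih =>
    intro σ hσ
    have h := shellStep hε hc hW hM (k₀ + j) (by positivity) ih σ hσ
    have e : k₀ + ((j + 1 : ℕ) : ℤ) = k₀ + (j : ℤ) + 1 := by push_cast; ring
    rw [e, pow_succ]
    calc ‖W (k₀ + ↑j + 1) σ‖
        ≤ bigLam ε₀ * fluxConst α * M * Real.exp (fluxConst α * (bigLam ε₀)⁻¹ * M) *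
          ((bigLam ε₀ * fluxConst α * M * Real.exp (fluxConst α * (bigLam ε₀)⁻¹ * M)) ^ j * S) := h
      _ = _ := by ring

/-- **Global form of the iterated shell step**: a shell bounded on all of `ℝ` bounds every shell above
it (each by `K^j` times the bound) — per-shell boundedness propagates UP the lattice; uniformity in the
shell index is exactly what it does not give when `K ≥ 1`.
[cite: Tao2016AveragedNS, §4 Lemma 4.1 (4.8)–(4.10) with (4.3), §6.4; cell vocabulary] -/
theorem shellStep_iter_global (hε : 0 < ε₀) (hc : IsCancellingCoeff α)
    (hW : IsEternalVisc ε₀ νh α W)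
    {M : ℝ} (hM : ∀ n : ℤ, Integrable (fun σ => ‖W n σ‖) ∧ ∫ σ, ‖W n σ‖ ≤ M)
    (k₀ : ℤ) {S : ℝ} (hS0 : 0 ≤ S) (hS : ∀ s, ‖W k₀ s‖ ≤ S) (j : ℕ) (σ : ℝ) :
    ‖W (k₀ + j) σ‖ ≤
      (bigLam ε₀ * fluxConst α * M * Real.exp (fluxConst α * (bigLam ε₀)⁻¹ * M)) ^ j * S :=
  shellStep_iter hε hc hW hM k₀ (σ₀ := σ) hS0 (fun s _ => hS s) j σ le_rfl

end ShellStepIter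

/-! ## The small-action Liouville theorem -/

section SmallAction

variable {m : ℕ} {ε₀ νh : ℝ} {α : Fin m → Fin m → Fin m → ℤ × ℤ × ℤ → ℝ} {W : ℤ → ℝ → Em m}

/-- **SMALL-ACTION LIOUVILLE THEOREM.**  On a cancelling table, a UNIFORMLY BOUNDED admissible
eternal solution (any covariant viscosity `ν̂ ≥ 0`, any `ε₀ > 0`) whose per-shell action bound `M`
makes the fed-spike factor `K = Λ C_A M e^{C_A M/Λ}` smaller than `1` is identically zero: by the
iterated shell step from shell `k − j`, `‖W_k(σ)‖ ≤ K^j C → 0`.  Equivalently: every NON-ZERO uniformly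
bounded admissible eternal solution has `Λ C_A M e^{C_A M/Λ} ≥ 1` for each of its action bounds `M`
(an explicit action floor).  This is the honest form of the «small-action» version of the crux
`WakeRatchet.AdmissibleEternalBound` (stmt-23197): under small action, `UniformBound W ↔ W = 0`, so the
crux restricted to small action is a LIOUVILLE statement, not a bound.
[cite: Tao2016AveragedNS, §4 Lemma 4.1 (4.8)–(4.10) with (4.3), Thm. 4.2 (statement shape), §6.4; cell vocabulary (`IsEternalVisc`, `UniformBound`)] -/
theorem eq_zero_of_uniformBound_of_fedFactor_lt_one (hε : 0 < ε₀) (hc : IsCancellingCoeff α)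
    (hW : IsEternalVisc ε₀ νh α W)
    {M : ℝ} (hM : ∀ n : ℤ, Integrable (fun σ => ‖W n σ‖) ∧ ∫ σ, ‖W n σ‖ ≤ M)
    (hK : bigLam ε₀ * fluxConst α * M * Real.exp (fluxConst α * (bigLam ε₀)⁻¹ * M) < 1)
    (hU : UniformBound W) : ∀ (k : ℤ) (σ : ℝ), W k σ = 0 := by
  have hS' := table_sTable α hc
  have hΛpos : 0 < bigLam ε₀ := bigLam_pos (by linarith)
  have hM0 : 0 ≤ M := le_trans (integral_nonneg fun _ => norm_nonneg _) (hM 0).2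
  have hCA : 0 ≤ fluxConst α := hS'.CA_nonneg
  set K : ℝ := bigLam ε₀ * fluxConst α * M * Real.exp (fluxConst α * (bigLam ε₀)⁻¹ * M) with hKdef
  have hK0 : 0 ≤ K := by positivity
  obtain ⟨C, hC⟩ := hU
  have hC0 : 0 ≤ C := (norm_nonneg _).trans (hC 0 0)
  intro k σ
  have hbound : ∀ j : ℕ, ‖W k σ‖ ≤ K ^ j * C := by
    intro j
    have h := shellStep_iter_global hε hc hW hM (k - j) hC0 (fun s => hC (k - j) s) j σ
    rwa [sub_add_cancel] at h
  have hlim : Tendsto (fun j : ℕ => K ^ j * C) atTop (𝓝 (0 * C)) :=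
    (tendsto_pow_atTop_nhds_zero_of_lt_one hK0 hK).mul_const C
  rw [zero_mul] at hlim
  have hle : ‖W k σ‖ ≤ 0 := ge_of_tendsto' hlim hbound
  exact norm_eq_zero.1 (le_antisymm hle (norm_nonneg _))

/-- **Explicit smallness:** `Λ C_A M ≤ 1/2` makes the fed-spike factor `< 1` (as `Λ ≥ 1`,
`C_A M/Λ ≤ 1/2` and `e^{1/2} < 2`).
[cite: Tao2016AveragedNS, §4 (Λ = (1+ε₀)^{5/2}); cell vocabulary] -/
theorem fedFactor_lt_one_of_le_half (hε : 0 < ε₀) {CA M : ℝ}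
    (h : bigLam ε₀ * CA * M ≤ 1 / 2) :
    bigLam ε₀ * CA * M * Real.exp (CA * (bigLam ε₀)⁻¹ * M) < 1 := by
  have hΛ1 : 1 ≤ bigLam ε₀ := one_le_bigLam hε.le
  have hΛpos : 0 < bigLam ε₀ := by linarith
  have hΛi1 : (bigLam ε₀)⁻¹ ≤ 1 := inv_le_one_of_one_le₀ hΛ1
  have hΛi0 : 0 ≤ (bigLam ε₀)⁻¹ := inv_nonneg.2 hΛpos.le
  -- `C_A M / Λ = (Λ C_A M) Λ⁻²  ≤ 1/2`
  have hx : CA * (bigLam ε₀)⁻¹ * M ≤ 1 / 2 := by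
    have e : CA * (bigLam ε₀)⁻¹ * M = (bigLam ε₀ * CA * M) * ((bigLam ε₀)⁻¹ * (bigLam ε₀)⁻¹) := by
      field_simp
    rw [e]
    have h2 : (bigLam ε₀)⁻¹ * (bigLam ε₀)⁻¹ ≤ 1 := by nlinarith
    calc bigLam ε₀ * CA * M * ((bigLam ε₀)⁻¹ * (bigLam ε₀)⁻¹) ≤ (1 / 2) * 1 :=
          mul_le_mul h h2 (by positivity) (by norm_num)
      _ = 1 / 2 := by ring
  -- `e^{x} < 2` for `x ≤ 1/2`: `(e^x)² = e^{2x} ≤ e < 3`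
  have hexp : Real.exp (CA * (bigLam ε₀)⁻¹ * M) < 2 := by
    set x := CA * (bigLam ε₀)⁻¹ * M with hxdef
    have hsq : Real.exp x * Real.exp x ≤ Real.exp 1 := by
      rw [← Real.exp_add]
      exact Real.exp_le_exp.2 (by linarith)
    have he : Real.exp 1 < 3 := lt_trans Real.exp_one_lt_d9 (by norm_num)
    have hpos : 0 < Real.exp x := Real.exp_pos _
    nlinarith
  have hexp0 : 0 < Real.exp (CA * (bigLam ε₀)⁻¹ * M) := Real.exp_pos _
  calc bigLam ε₀ * CA * M * Real.exp (CA * (bigLam ε₀)⁻¹ * M)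
      ≤ (1 / 2) * Real.exp (CA * (bigLam ε₀)⁻¹ * M) := mul_le_mul_of_nonneg_right h hexp0.le
    _ < (1 / 2) * 2 := by nlinarith
    _ = 1 := by norm_num

/-- **Small-action Liouville, explicit threshold:** on a cancelling table, a uniformly bounded
admissible eternal solution with per-shell action `∫‖W_n‖ ≤ M`, `Λ C_A M ≤ 1/2`, is zero.
[cite: Tao2016AveragedNS, §4 Lemma 4.1 (4.8)–(4.10) with (4.3), Thm. 4.2 (statement shape), §6.4; cell vocabulary] -/
theorem eq_zero_of_uniformBound_of_action_le_half (hε : 0 < ε₀) (hc : IsCancellingCoeff α)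
    (hW : IsEternalVisc ε₀ νh α W)
    {M : ℝ} (hM : ∀ n : ℤ, Integrable (fun σ => ‖W n σ‖) ∧ ∫ σ, ‖W n σ‖ ≤ M)
    (hsmall : bigLam ε₀ * fluxConst α * M ≤ 1 / 2) (hU : UniformBound W) :
    ∀ (k : ℤ) (σ : ℝ), W k σ = 0 :=
  eq_zero_of_uniformBound_of_fedFactor_lt_one hε hc hW hM
    (fedFactor_lt_one_of_le_half hε hsmall) hU

/-- **Action floor for non-trivial bounded eternal solutions** (contrapositive): a uniformly bounded
admissible eternal solution of a cancelling table that is not identically zero has per-shell action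
bounds `M > 1/(2 Λ C_A)` only, i.e. `Λ C_A M > 1/2` for every admissible `M`.
[cite: Tao2016AveragedNS, §4 Lemma 4.1 (4.8)–(4.10) with (4.3), §6.4; cell vocabulary] -/
theorem half_lt_action_of_ne_zero (hε : 0 < ε₀) (hc : IsCancellingCoeff α)
    (hW : IsEternalVisc ε₀ νh α W) (hU : UniformBound W) (hne : ∃ k σ, W k σ ≠ 0)
    {M : ℝ} (hM : ∀ n : ℤ, Integrable (fun σ => ‖W n σ‖) ∧ ∫ σ, ‖W n σ‖ ≤ M) :
    1 / 2 < bigLam ε₀ * fluxConst α * M := by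
  by_contra h
  push Not at h
  obtain ⟨k, σ, hkσ⟩ := hne
  exact hkσ (eq_zero_of_uniformBound_of_action_le_half hε hc hW hM h hU k σ)

end SmallAction

/-! ## What the crux adds: small action ⇒ zero WITHOUT the boundedness hypothesis -/

/-- **`AdmissibleEternalBound` ⟹ unconditional small-action Liouville.**  If the crux
`WakeRatchet.AdmissibleEternalBound` (stmt-NavierStokesRegularity-23197) holds, then below its
threshold every admissible eternal solution of an E₂(R) table with per-shell action `Λ C_A M ≤ 1/2` is
identically zero — the boundedness hypothesis of `eq_zero_of_uniformBound_of_action_le_half` being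
supplied by the crux.  Read contrapositively this is a KILL CRITERION for the crux (companion negative
file): one persistent family of NON-ZERO small-action admissible eternal solutions on a fixed-spread
table refutes it.  MODEL lattice only; nothing here is a statement about the Navier–Stokes equations
and no summit is advanced by it.
[cite: Tao2016AveragedNS, §4 Thm. 4.2 (statement shape), Lemma 4.1 (4.8)–(4.10), §6.4; cell vocabulary] -/
theorem smallActionLiouville_of_admissibleEternalBound
    (h : Summit.NavierStokesRegularity.NavierStokesRegularity.Theses.WakeRatchet.AdmissibleEternalBound) :
    ∀ R : ℝ, 1 ≤ R → ∃ εs : ℝ, 0 < εs ∧ ∀ ε₀ : ℝ, 0 < ε₀ → ε₀ ≤ εs →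
      ∀ α : Fin 4 → Fin 4 → Fin 4 → ℤ × ℤ × ℤ → ℝ, InTableClass R α →
        ∀ (νh : ℝ) (W : ℤ → ℝ → Em 4) (M : ℝ), IsEternalVisc ε₀ νh α W →
          (∀ n : ℤ, Integrable (fun σ => ‖W n σ‖) ∧ ∫ σ, ‖W n σ‖ ≤ M) →
          bigLam ε₀ * fluxConst α * M ≤ 1 / 2 → ∀ (k : ℤ) (σ : ℝ), W k σ = 0 := by
  intro R hR
  obtain ⟨εs, hεs, H⟩ := h R hR
  refine ⟨εs, hεs, fun ε₀ hε₀ hle α hα νh W M hW hM hsmall => ?_⟩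
  exact eq_zero_of_uniformBound_of_action_le_half hε₀ hα.2.1 hW hM hsmall
    (H ε₀ hε₀ hle α hα νh W hW)


/-- **KILL CRITERION for `AdmissibleEternalBound` (conditional refutation, contrapositive of
`smallActionLiouville_of_admissibleEternalBound`).**  ONE spread `R ≥ 1` carrying, at arbitrarily
small scale ratios `ε₀`, E₂(R) tables with NON-ZERO admissible eternal solutions (any covariant
viscosity `ν̂ ≥ 0`) of SMALL action `Λ C_A M ≤ 1/2` refutes the crux — such solutions are necessarily
unbounded (`eq_zero_of_uniformBound_of_action_le_half`), with shell suprema growing at least like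
`K^{-j}` DOWN the lattice (`shellStep_iter`).  No such family is known or constructed here; this is a
test any proof of the crux must survive, not a refutation.  MODEL lattice only; nothing about NS.
[cite: Tao2016AveragedNS, §4 Thm. 4.2 (statement shape), Lemma 4.1 (4.8)–(4.10), §6.4; cell vocabulary] -/
theorem admissibleEternalBound_false_of_smallActionFamily {R : ℝ} (hR : 1 ≤ R)
    (hF : ∀ ε : ℝ, 0 < ε → ∃ ε₀ : ℝ, 0 < ε₀ ∧ ε₀ ≤ ε ∧
      ∃ α : Fin 4 → Fin 4 → Fin 4 → ℤ × ℤ × ℤ → ℝ, InTableClass R α ∧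
        ∃ (νh : ℝ) (W : ℤ → ℝ → Em 4) (M : ℝ), IsEternalVisc ε₀ νh α W ∧
          (∀ n : ℤ, Integrable (fun σ => ‖W n σ‖) ∧ ∫ σ, ‖W n σ‖ ≤ M) ∧
          bigLam ε₀ * fluxConst α * M ≤ 1 / 2 ∧ ∃ (k : ℤ) (σ : ℝ), W k σ ≠ 0) :
    ¬ Summit.NavierStokesRegularity.NavierStokesRegularity.Theses.WakeRatchet.AdmissibleEternalBound := by
  intro h
  obtain ⟨εs, hεs, H⟩ := smallActionLiouville_of_admissibleEternalBound h R hR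
  obtain ⟨ε₀, hε₀, hle, α, hα, νh, W, M, hW, hM, hsmall, k, σ, hne⟩ := hF εs hεs
  exact hne (H ε₀ hε₀ hle α hα νh W M hW hM hsmall k σ)


end WakeRatchetSmallAction

end Summit.NavierStokesRegularity.NavierStokesRegularity.Theorems

end
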